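import Summits.QuantumFields.YangMills.Theorems.BalabanUVNodesN15SiteColouredSocket
import HarnessLib

/-!
# Route «BalabanUVNodes», cluster K4 «SpineRates» — node N15 = NE2: THE SITE LAYER WITH THE BACKGROUND LIVE IN THE TwoGrid ENTRY CURRENCY, XXII — THE COLOURED (3.65) WORDS:
# the site perturbation `Q(X(X − G) + (X − G)G)Q*` of a COLOURED fine-site layer over the COLOURED unit-torus sites `Tor M × ι` (blocks = the site, colour free), its size and
# two-grid letters from block letters (dag-n15-c S2 with the site blocks `fst`), its coloured site matrix on `Idx M × ι` (part XXI's perturbation slot) with the entry letters,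
# and the three letters of part XXI's coloured socket from a dressed coloured layer's block letters, READ AT SIZE — part V ∕ part XI §2's words on the coloured carrier

Cell `pub-ymgap`, WIDTH SEAT `pub-ymgap-dag-n15-w1` (generation 3; director-ym №197 ∕ HUMAN RULING D-0149; chair R455 (A) ∕ R461; plan g83 `W-SEAT-START-LIST.md` v11 §n15; (α) step 2 of 4).
`bears_on: R4∕N15 · K3⁷ SpineGivenEndpointR13SepCoPH (stmt-QuantumFields-20544)`.  Filed `--supports stmt-QuantumFields-20544 --as helper` — COUNT-NEUTRAL.  Two plumbing `def`s (`sitePertC`,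
`siteEntriesC`), the rest theorems; 0 `sorry`.  Imports BY NAME this seat's part XXI `…N15SiteColouredSocket` (through it dag-n15-c S2 `siteForm`∕`siteForm₀`∕`hasMaj_siteC`∕`hasMaj_idef_siteForm`,
part V `idef_zero_zero`, lit `entry_le_of_hasMaj`, `unitTorusGeoS`, `torIdx`, `tdist`); nothing in the tree is modified.

WHY.  Part XXI's socket consumes coloured site perturbations `P(U) ∈ Matrix (Idx M × ι)` with three letters decaying in the SITE distance.  The (3.65) perturbation of a coloured
dressed layer `X(U)` (colours mixed) against the coloured `U ≡ 1` layer `G ⊗ 1_ι` is dag-n15-c S2's `siteForm q 0 0 X − siteForm₀ q G` with `q : Xc × ι → Tor M × ι` the block map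
lifted in colour and the site lattice `Y = Tor M × ι` blocked by `fst` (one unit-torus site, every colour) — S2's words are generic in `(blk, blkY, q)`, so the size letter and the
two-grid letter follow VERBATIM (part V's proofs with `blkY := fst`).  The site matrix is read through `torIdx` on the first component; its entries are bounded by the block majorant
(`entry_le_of_hasMaj` at the `fst` blocks).  §3 then packages, exactly as part V §3 did for the scalar words but AT SIZE (part XI's smallness `s = M_sz·α₀`), the three socket letters
from a dressed coloured layer's displayed block letters.

CONTENTS.  §1 `sitePertC` (+ `_eq`, `sitePertC_self`), ★ `hasMaj_sitePertC`, `sitePertC_sub`, ★ `hasMaj_sitePertC_sub`; §2 `siteEntriesC` (+ `_apply`, `_sub`), ★ `abs_siteEntriesC_le_of_hasMaj`;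
§3 ★★ `siteLettersC_of_sizedDressedLetters` (part XXI's `hP`, sized, from block letters `β, B, ε·s, m·θ, m₀·θ` at rate `δ`; constants `(δ∕2, (B+β)εc_δ + 1, 2c_δ(Bm + βm₀) + 1, a₁)`).

HONEST FRAMING.  Count-neutral words ∕ bookkeeping; no new estimate (S2's block algebra and King's torus sums are the tree's).  The averaging species `F₂` is DROPPED here (`F = F* = 0`,
as part V) — the coloured averaging words are a later corner.  NOT [B9] Thm 3.2 at a general (3.35)-regular `U` (NE2⁺ NOT PRINTED as an η-rate); Node 00's [B9] layers of record are
residual — **N15 is NOT discharged** (typed 28∕28 · discharged 5∕27 of record unchanged); K3⁷ OPEN, its N15 pin untouched; one finite four-torus programme at fixed `ε` — NOT ℝ⁴, NOT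
infinite volume, NOT OS, NOT a mass gap, NOT Clay; R4 closes the conditional finite-𝕋⁴ rung `BalabanLadder.UV` only.  Restate-immune.
-/

set_option autoImplicit false

noncomputable section

open scoped BigOperators Matrix
open Finset

namespace Summit.QuantumFields.YangMills.BalabanUVNodes.N15.SiteLayerBg

open Literature.MathematicalPhysics.QuantumFieldTheory.Balaban1983to89
open Literature.MathematicalPhysics.QuantumFieldTheory.Balaban1983to89.B11SectG (BlockNorm HasMaj RowSum hasMaj_zero)
open Literature.MathematicalPhysics.QuantumFieldTheory.Balaban1983to89.T4EtaRateDefect (idef)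
open Literature.MathematicalPhysics.QuantumFieldTheory.Balaban1983to89.T4EtaRateDefectSite (entry entry_le_of_hasMaj)
open Literature.MathematicalPhysics.QuantumFieldTheory.Balaban1983to89.T4EtaRateCoeffDefect (pull diagK diagK_nonneg fibre)
open Literature.MathematicalPhysics.QuantumFieldTheory.Balaban1983to89.B5Prop11Plancherel (Tor fine)
open Literature.MathematicalPhysics.QuantumFieldTheory.Balaban1983to89.B4Sect5Torus (tdist)
open Literature.MathematicalPhysics.QuantumFieldTheory.Balaban1983to89.B4Sect5Proof (latticeConst latticeConst_nonneg)
open Literature.MathematicalPhysics.QuantumFieldTheory.Balaban1983to89.B5QGGQ145Bounds (Idx)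
open Literature.MathematicalPhysics.QuantumFieldTheory.Balaban1983to89.B5PBridgeProjection (torIdx)
open Literature.MathematicalPhysics.QuantumFieldTheory.Balaban1983to89.B6UnitTorusCarrier (triangle254_unitTorusGeo rowSum_unitTorusGeo)
open Literature.MathematicalPhysics.QuantumFieldTheory.King1986.Torus (tdistT tdistT_nonneg)
open Summit.QuantumFields.YangMills.BalabanUVNodes.N15.VectorPiece (unitTorusGeoS unitTorusGeoS_dist)
open Summit.QuantumFields.YangMills.BalabanUVNodes.N15.TwoGrid (tdistT_eq_tdist_torIdx)
open Summit.QuantumFields.YangMills.BalabanUVNodes.N15.SiteLayer (siteForm siteForm₀ hasMaj_siteC hasMaj_idef_siteForm)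

variable {d : ℕ} {L : ℕ}

/-! ## §1 The coloured (3.65) words over the coloured unit-torus sites and their two block letters -/

section Words

variable {Xc : Type} [Fintype Xc] (M : Fin (d + 1) → ℕ) (ι : Type) [DecidableEq ι]

/-- **THE COLOURED SITE PERTURBATION OF (3.65), AVERAGING SPECIES DROPPED**: `siteForm q 0 0 X − siteForm₀ q G = Q∘(X∘(X − G) + (X − G)∘G)∘Q*` (dag-n15-c S2) for a coloured `U ≡ 1` layer
`G` and a (colour-mixing) dressed layer `X` on a coloured fine-site carrier `Xc` over the coloured unit-torus sites `Tor M × ι` (`q` = the colour-lifted block map).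
[cite: Balaban1985BackgroundPropagators, (3.65) p.403 (shape); (3.1)–(3.5) p.390 (the scalar fields carry a representation `R(U)`: colour)] -/
def sitePertC (q : Xc → Tor M × ι) (G Xo : (Xc → ℝ) →ₗ[ℝ] (Xc → ℝ)) : (Tor M × ι → ℝ) →ₗ[ℝ] (Tor M × ι → ℝ) :=
  siteForm q 0 0 Xo - siteForm₀ q G

/-- Unfolding. [folklore] -/
theorem sitePertC_eq (q : Xc → Tor M × ι) (G Xo : (Xc → ℝ) →ₗ[ℝ] (Xc → ℝ)) : sitePertC M ι q G Xo = siteForm q 0 0 Xo - siteForm₀ q G := rfl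

omit [DecidableEq ι] in
/-- `siteForm q 0 0 G = siteForm₀ q G` on any site lattice. [folklore] -/
theorem siteForm_zero_zero' {Y : Type} [DecidableEq Y] (q : Xc → Y) (G : (Xc → ℝ) →ₗ[ℝ] (Xc → ℝ)) : siteForm q 0 0 G = siteForm₀ q G := by
  unfold siteForm siteForm₀
  rw [add_zero, add_zero]

/-- At `X = G` the coloured site perturbation vanishes. [folklore] -/
theorem sitePertC_self (q : Xc → Tor M × ι) (G : (Xc → ℝ) →ₗ[ℝ] (Xc → ℝ)) : sitePertC M ι q G G = 0 := by
  unfold sitePertC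
  rw [siteForm_zero_zero', sub_self]

variable (L)

/-- ★ **THE SIZE LETTER** of the coloured site perturbation on the sized unit-torus carrier `g = unitTorusGeoS L k M M_sz` (fine-site blocks `fst ∘ q`, site blocks `fst`): from `X ≤ B·e^{−δd}`,
`G ≤ β·e^{−δd}`, `X − G ≤ ε·e^{−δd}` (`B, β, ε ≥ 0`, `δ > 0`): `sitePertC q G X ≤ (B + β)·ε·c_δ·e^{−(δ∕2)d}` (S2 `hasMaj_siteC` at `r = 0`, `blkY := fst`).
[cite: Balaban1985BackgroundPropagators, (3.66) p.403 (shape)] -/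
theorem hasMaj_sitePertC [NeZero L] [∀ μ, NeZero (M μ)] [Fintype ι] (k : ℕ) (Msz : ℝ) (q : Xc → Tor M × ι) {G Xo : (Xc → ℝ) →ₗ[ℝ] (Xc → ℝ)} {B β ε δ : ℝ} (hB : 0 ≤ B) (hβ : 0 ≤ β)
    (hε : 0 ≤ ε) (hδ : 0 < δ)
    (hX : HasMaj (BlockNorm.ofBlocks (unitTorusGeoS L k M Msz) (fun x => (q x).1)) (BlockNorm.ofBlocks (unitTorusGeoS L k M Msz) (fun x => (q x).1)) Xo
      (fun y y' => B * Real.exp (-(δ * (unitTorusGeoS L k M Msz).dist y y'))))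
    (hG : HasMaj (BlockNorm.ofBlocks (unitTorusGeoS L k M Msz) (fun x => (q x).1)) (BlockNorm.ofBlocks (unitTorusGeoS L k M Msz) (fun x => (q x).1)) G
      (fun y y' => β * Real.exp (-(δ * (unitTorusGeoS L k M Msz).dist y y'))))
    (hE : HasMaj (BlockNorm.ofBlocks (unitTorusGeoS L k M Msz) (fun x => (q x).1)) (BlockNorm.ofBlocks (unitTorusGeoS L k M Msz) (fun x => (q x).1)) (Xo - G)
      (fun y y' => ε * Real.exp (-(δ * (unitTorusGeoS L k M Msz).dist y y')))) :
    HasMaj (BlockNorm.ofBlocks (unitTorusGeoS L k M Msz) (fun p : Tor M × ι => p.1)) (BlockNorm.ofBlocks (unitTorusGeoS L k M Msz) (fun p : Tor M × ι => p.1))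
      (sitePertC M ι q G Xo) (fun y y' => (B + β) * ε * latticeConst (d + 1) (δ / 2) * Real.exp (-(δ / 2 * (unitTorusGeoS L k M Msz).dist y y'))) := by
  have hK : 0 ≤ latticeConst (d + 1) (δ / 2) := latticeConst_nonneg _ (by positivity)
  have h := hasMaj_siteC (g := unitTorusGeoS L k M Msz) (σ := δ / 2) (cr := latticeConst (d + 1) (δ / 2)) (triangle254_unitTorusGeo L k M)
    (fun a b => tdistT_nonneg M a b) (rowSum_unitTorusGeo L k M (half_pos hδ)) (by positivity) hK (fun x => (q x).1) (fun p : Tor M × ι => p.1) q (fun _ => rfl)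
    (F := 0) (Fs := 0) hB hβ hε le_rfl (by positivity : (0 : ℝ) ≤ δ / 2) (by linarith) hX hG hE
    ((hasMaj_zero _ _).mono fun _ _ => diagK_nonneg (fun _ => le_rfl) _ _) ((hasMaj_zero _ _).mono fun _ _ => diagK_nonneg (fun _ => le_rfl) _ _)
  refine h.mono fun y y' => le_of_eq ?_
  show (0 * (B * B * (1 + 0)) + B * B * 0 + (B + β) * ε) * latticeConst (d + 1) (δ / 2) * Real.exp (-(δ / 2 * (unitTorusGeoS L k M Msz).dist y y')) = _
  ring

variable {L}

/-- **THE TWO-GRID DIFFERENCE OF THE COLOURED WORDS IS A DIFFERENCE OF TWO η-DEFECTS** through the identity transport of the common coloured site lattice. [folklore] -/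
theorem sitePertC_sub {Xf : Type} [Fintype Xf] (q : Xc → Tor M × ι) (π : Xf → Xc) (G Xo : (Xc → ℝ) →ₗ[ℝ] (Xc → ℝ)) (G' Xo' : (Xf → ℝ) →ₗ[ℝ] (Xf → ℝ)) :
    sitePertC M ι (q ∘ π) G' Xo' - sitePertC M ι q G Xo =
      idef LinearMap.id LinearMap.id (siteForm (q ∘ π) 0 0 Xo') (siteForm q 0 0 Xo) - idef LinearMap.id LinearMap.id (siteForm (q ∘ π) 0 0 G') (siteForm q 0 0 G) := by
  unfold sitePertC idef
  rw [siteForm_zero_zero', siteForm_zero_zero', siteForm_zero_zero', siteForm_zero_zero', LinearMap.comp_id, LinearMap.id_comp, LinearMap.comp_id, LinearMap.id_comp]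
  abel

variable (L)

/-- ★ **THE TWO-GRID LETTER** of the coloured site perturbations (fine `(q ∘ π, G′, X′)` against coarse `(q, G, X)`, King's pairing `π` lifted in colour, UNIFORM fibres `#π⁻¹x = N ≥ 1`): from
`X, X′ ≤ B·e^{−δd}`, `G, G′ ≤ β·e^{−δd}`, `𝔇^π(X′, X) ≤ m·e^{−δd}`, `𝔇^π(G′, G) ≤ m₀·e^{−δd}` (`B, β, m, m₀ ≥ 0`, `δ > 0`): `C′ − C ≤ 2c_δ(B·m + β·m₀)·e^{−(δ∕2)d}` between the sharp site norms
(S2 `hasMaj_idef_siteForm` twice at `blkY := fst`). [cite: Balaban1985BackgroundPropagators, (3.65)–(3.66) p.403 (mechanism); King1986, p.664 (pairing convention)] -/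
theorem hasMaj_sitePertC_sub [NeZero L] [∀ μ, NeZero (M μ)] [Fintype ι] [DecidableEq Xc] {Xf : Type} [Fintype Xf] (k : ℕ) (Msz : ℝ) (q : Xc → Tor M × ι) (π : Xf → Xc) {N : ℕ} (hN : N ≠ 0)
    (hfib : ∀ x, (fibre π x).card = N) {G Xo : (Xc → ℝ) →ₗ[ℝ] (Xc → ℝ)} {G' Xo' : (Xf → ℝ) →ₗ[ℝ] (Xf → ℝ)} {B β m m₀ δ : ℝ}
    (hB : 0 ≤ B) (hβ : 0 ≤ β) (hm : 0 ≤ m) (hm₀ : 0 ≤ m₀) (hδ : 0 < δ)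
    (hX : HasMaj (BlockNorm.ofBlocks (unitTorusGeoS L k M Msz) (fun x => (q x).1)) (BlockNorm.ofBlocks (unitTorusGeoS L k M Msz) (fun x => (q x).1)) Xo
      (fun y y' => B * Real.exp (-(δ * (unitTorusGeoS L k M Msz).dist y y'))))
    (hX' : HasMaj (BlockNorm.ofBlocks (unitTorusGeoS L k M Msz) (fun x' => (q (π x')).1)) (BlockNorm.ofBlocks (unitTorusGeoS L k M Msz) (fun x' => (q (π x')).1)) Xo'
      (fun y y' => B * Real.exp (-(δ * (unitTorusGeoS L k M Msz).dist y y'))))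
    (hDX : HasMaj (BlockNorm.ofBlocks (unitTorusGeoS L k M Msz) (fun x => (q x).1)) (BlockNorm.ofBlocks (unitTorusGeoS L k M Msz) (fun x' => (q (π x')).1))
      (idef (pull π) (pull π) Xo' Xo) (fun y y' => m * Real.exp (-(δ * (unitTorusGeoS L k M Msz).dist y y'))))
    (hG : HasMaj (BlockNorm.ofBlocks (unitTorusGeoS L k M Msz) (fun x => (q x).1)) (BlockNorm.ofBlocks (unitTorusGeoS L k M Msz) (fun x => (q x).1)) G
      (fun y y' => β * Real.exp (-(δ * (unitTorusGeoS L k M Msz).dist y y'))))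
    (hG' : HasMaj (BlockNorm.ofBlocks (unitTorusGeoS L k M Msz) (fun x' => (q (π x')).1)) (BlockNorm.ofBlocks (unitTorusGeoS L k M Msz) (fun x' => (q (π x')).1)) G'
      (fun y y' => β * Real.exp (-(δ * (unitTorusGeoS L k M Msz).dist y y'))))
    (hDG : HasMaj (BlockNorm.ofBlocks (unitTorusGeoS L k M Msz) (fun x => (q x).1)) (BlockNorm.ofBlocks (unitTorusGeoS L k M Msz) (fun x' => (q (π x')).1))
      (idef (pull π) (pull π) G' G) (fun y y' => m₀ * Real.exp (-(δ * (unitTorusGeoS L k M Msz).dist y y')))) :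
    HasMaj (BlockNorm.ofBlocks (unitTorusGeoS L k M Msz) (fun p : Tor M × ι => p.1)) (BlockNorm.ofBlocks (unitTorusGeoS L k M Msz) (fun p : Tor M × ι => p.1))
      (sitePertC M ι (q ∘ π) G' Xo' - sitePertC M ι q G Xo)
      (fun y y' => 2 * latticeConst (d + 1) (δ / 2) * (B * m + β * m₀) * Real.exp (-(δ / 2 * (unitTorusGeoS L k M Msz).dist y y'))) := by
  have hK : 0 ≤ latticeConst (d + 1) (δ / 2) := latticeConst_nonneg _ (by positivity)
  have htri := triangle254_unitTorusGeo L k M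
  have hrow := rowSum_unitTorusGeo L k M (half_pos hδ)
  have hd : ∀ a b : (unitTorusGeoS L k M Msz).Site, 0 ≤ (unitTorusGeoS L k M Msz).dist a b := fun a b => tdistT_nonneg M a b
  have z1 : HasMaj (BlockNorm.ofBlocks (unitTorusGeoS L k M Msz) (fun p : Tor M × ι => p.1)) (BlockNorm.ofBlocks (unitTorusGeoS L k M Msz) (fun x => (q x).1))
      (0 : (Tor M × ι → ℝ) →ₗ[ℝ] (Xc → ℝ)) (diagK fun _ => 0) := (hasMaj_zero _ _).mono fun _ _ => diagK_nonneg (fun _ => le_rfl) _ _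
  have z2 : HasMaj (BlockNorm.ofBlocks (unitTorusGeoS L k M Msz) (fun x' => (q (π x')).1)) (BlockNorm.ofBlocks (unitTorusGeoS L k M Msz) (fun p : Tor M × ι => p.1))
      (0 : (Xf → ℝ) →ₗ[ℝ] (Tor M × ι → ℝ)) (diagK fun _ => 0) := (hasMaj_zero _ _).mono fun _ _ => diagK_nonneg (fun _ => le_rfl) _ _
  have z3 : HasMaj (BlockNorm.ofBlocks (unitTorusGeoS L k M Msz) (fun p : Tor M × ι => p.1)) (BlockNorm.ofBlocks (unitTorusGeoS L k M Msz) (fun x' => (q (π x')).1))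
      (0 : (Tor M × ι → ℝ) →ₗ[ℝ] (Xf → ℝ)) (diagK fun _ => 0) := (hasMaj_zero _ _).mono fun _ _ => diagK_nonneg (fun _ => le_rfl) _ _
  have z4 : HasMaj (BlockNorm.ofBlocks (unitTorusGeoS L k M Msz) (fun x => (q x).1)) (BlockNorm.ofBlocks (unitTorusGeoS L k M Msz) (fun p : Tor M × ι => p.1))
      (idef (pull π) LinearMap.id (0 : (Xf → ℝ) →ₗ[ℝ] (Tor M × ι → ℝ)) (0 : (Xc → ℝ) →ₗ[ℝ] (Tor M × ι → ℝ))) (diagK fun _ => 0) := by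
    rw [idef_zero_zero]; exact (hasMaj_zero _ _).mono fun _ _ => diagK_nonneg (fun _ => le_rfl) _ _
  have z5 : HasMaj (BlockNorm.ofBlocks (unitTorusGeoS L k M Msz) (fun p : Tor M × ι => p.1)) (BlockNorm.ofBlocks (unitTorusGeoS L k M Msz) (fun x' => (q (π x')).1))
      (idef LinearMap.id (pull π) (0 : (Tor M × ι → ℝ) →ₗ[ℝ] (Xf → ℝ)) (0 : (Tor M × ι → ℝ) →ₗ[ℝ] (Xc → ℝ))) (diagK fun _ => 0) := by
    rw [idef_zero_zero]; exact (hasMaj_zero _ _).mono fun _ _ => diagK_nonneg (fun _ => le_rfl) _ _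
  have h1 := hasMaj_idef_siteForm (g := unitTorusGeoS L k M Msz) (σ := δ / 2) (cr := latticeConst (d + 1) (δ / 2)) htri hd hrow (by positivity)
    (fun x => (q x).1) (fun p : Tor M × ι => p.1) q π (fun _ => rfl) hN hfib hB hm le_rfl le_rfl (by positivity : (0 : ℝ) ≤ δ / 2) (by linarith) hX hX' hDX z1 z2 z3 z4 z5
  have h2 := hasMaj_idef_siteForm (g := unitTorusGeoS L k M Msz) (σ := δ / 2) (cr := latticeConst (d + 1) (δ / 2)) htri hd hrow (by positivity)
    (fun x => (q x).1) (fun p : Tor M × ι => p.1) q π (fun _ => rfl) hN hfib hβ hm₀ le_rfl le_rfl (by positivity : (0 : ℝ) ≤ δ / 2) (by linarith) hG hG' hDG z1 z2 z3 z4 z5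
  rw [sitePertC_sub]
  refine (h1.sub h2).mono fun y y' => le_of_eq ?_
  ring

end Words

/-! ## §2 The coloured site matrix of a map on coloured unit-torus site functions; entries from a block majorant -/

section SiteMat

variable (M : Fin (d + 1) → ℕ) [∀ μ, NeZero (M μ)] (ι : Type) [DecidableEq ι]

/-- THE COLOURED SITE MATRIX of a linear map on the coloured unit-torus site functions, on `Idx M × ι` (sites through the chart `torIdx`): `T(δ_{(q,j)})(p,i)`. [folklore] -/
def siteEntriesC (T : (Tor M × ι → ℝ) →ₗ[ℝ] (Tor M × ι → ℝ)) : Matrix (Idx M × ι) (Idx M × ι) ℝ :=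
  fun p q => entry T ((torIdx M).symm p.1, p.2) ((torIdx M).symm q.1, q.2)

/-- Unfolding of `siteEntriesC`. [folklore] -/
theorem siteEntriesC_apply (T : (Tor M × ι → ℝ) →ₗ[ℝ] (Tor M × ι → ℝ)) (p q : Idx M × ι) :
    siteEntriesC M ι T p q = T (Pi.single ((torIdx M).symm q.1, q.2) 1) ((torIdx M).symm p.1, p.2) := rfl

/-- `siteEntriesC` of a difference. [folklore] -/
theorem siteEntriesC_sub (T T' : (Tor M × ι → ℝ) →ₗ[ℝ] (Tor M × ι → ℝ)) : siteEntriesC M ι (T - T') = siteEntriesC M ι T - siteEntriesC M ι T' := by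
  ext p q
  simp only [siteEntriesC_apply, Matrix.sub_apply, LinearMap.sub_apply, Pi.sub_apply]

/-- ★ **COLOURED ENTRIES FROM A BLOCK MAJORANT ON THE SIZED UNIT-TORUS CARRIER** (site blocks `fst`: one site, every colour): `T ≤ A·e^{−ρd}` between the sharp site norms of
`unitTorusGeoS L k M M_sz` ⟹ `|siteEntriesC T ((p,i),(q,j))| ≤ A·e^{−ρ·tdist(p,q)}` — uniform in the colours (`entry_le_of_hasMaj` at the `fst` blocks, `tdistT = tdist ∘ torIdx`). [folklore] -/
theorem abs_siteEntriesC_le_of_hasMaj [NeZero L] [Fintype ι] (k : ℕ) (Msz : ℝ) {T : (Tor M × ι → ℝ) →ₗ[ℝ] (Tor M × ι → ℝ)} {A ρ : ℝ}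
    (h : HasMaj (BlockNorm.ofBlocks (unitTorusGeoS L k M Msz) (fun p : Tor M × ι => p.1)) (BlockNorm.ofBlocks (unitTorusGeoS L k M Msz) (fun p : Tor M × ι => p.1)) T
      (fun y y' => A * Real.exp (-(ρ * (unitTorusGeoS L k M Msz).dist y y')))) (p q : Idx M × ι) :
    |siteEntriesC M ι T p q| ≤ A * Real.exp (-(ρ * tdist M p.1 q.1)) := by
  have h1 := entry_le_of_hasMaj (g := unitTorusGeoS L k M Msz) (fun p : Tor M × ι => p.1) (fun p : Tor M × ι => p.1) h ((torIdx M).symm p.1, p.2) ((torIdx M).symm q.1, q.2)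
  have hd : tdistT M ((torIdx M).symm p.1) ((torIdx M).symm q.1) = tdist M p.1 q.1 := by
    rw [tdistT_eq_tdist_torIdx, Equiv.apply_symm_apply, Equiv.apply_symm_apply]
  calc |siteEntriesC M ι T p q| = |entry T ((torIdx M).symm p.1, p.2) ((torIdx M).symm q.1, q.2)| := rfl
    _ ≤ A * Real.exp (-(ρ * tdistT M ((torIdx M).symm p.1) ((torIdx M).symm q.1))) := h1
    _ = A * Real.exp (-(ρ * tdist M p.1 q.1)) := by rw [hd]

end SiteMat

/-! ## §3 ★★ The three letters of part XXI's coloured socket from a dressed coloured layer's block letters, read at size -/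

section Letters

variable [NeZero L] {I : Type} (ι : Type) [Fintype ι] [DecidableEq ι] (Mn : I → Fin (d + 1) → ℕ) [hMn0 : ∀ i μ, NeZero (Mn i μ)] (kk : I → ℕ) (Msz : I → ℝ)
  (Xc Xf : I → Type) [∀ i, Fintype (Xc i)] [∀ i, DecidableEq (Xc i)] [∀ i, Fintype (Xf i)] (q : ∀ i, Xc i → Tor (Mn i) × ι) (π : ∀ i, Xf i → Xc i)
  (Bc Bf : I → B9.Backgrounds) (avg : ∀ i, (Bf i).Cfg → (Bc i).Cfg)
  (Gc : ∀ i, (Xc i → ℝ) →ₗ[ℝ] (Xc i → ℝ)) (Gf : ∀ i, (Xf i → ℝ) →ₗ[ℝ] (Xf i → ℝ))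
  (Xco : ∀ i, (Bc i).Cfg → (Xc i → ℝ) →ₗ[ℝ] (Xc i → ℝ)) (Xfo : ∀ i, (Bf i).Cfg → (Xf i → ℝ) →ₗ[ℝ] (Xf i → ℝ))

/-- ★★ **THE COLOURED SOCKET's THREE LETTERS FROM A DRESSED COLOURED LAYER's BLOCK LETTERS, READ AT SIZE.**  Data per index `i`: the sized unit-torus carrier `g_i = unitTorusGeoS L (k i) (M i) (M_sz i)`,
a coloured coarse fine-site carrier `Xc i` over the coloured sites by `q i`, a fine one `Xf i` paired by `π i` with UNIFORM fibres, the coloured `U ≡ 1` layers `Gc i ∕ Gf i` and the DRESSED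
layers `Xco i V ∕ Xfo i U`.  LETTERS (smallness `s = M_sz i·α₀ ≤ a₁`, rate `θ_i = (L^{k i})^{−γ_P}`): `Gc, Gf ≤ β·e^{−δd}`, `𝔇^π(Gf, Gc) ≤ m₀θ_i·e^{−δd}`, and under `Reg335 c₃₅ α₀ U`:
`Xco(Ū), Xfo(U) ≤ B·e^{−δd}`, `Xco(Ū) − Gc, Xfo(U) − Gf ≤ ε·s·e^{−δd}`, `𝔇^π(Xfo(U), Xco(Ū)) ≤ mθ_i·e^{−δd}`.  CONCLUSION: part XXI's sized `hP` for
`Pf i U := siteEntriesC (sitePertC (q i ∘ π i) (Gf i) (Xfo i U))`, `Pc i V := siteEntriesC (sitePertC (q i) (Gc i) (Xco i V))` with `(δ_P, ζ, τ, a₁) = (δ∕2, (B+β)εc_δ + 1, 2c_δ(Bm + βm₀) + 1, a₁)`.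
[cite: Balaban1985BackgroundPropagators, (3.65)–(3.67) p.403 (mechanism), (3.35) p.396 (the letters at size); King1986, p.664 (pairing)] -/
theorem siteLettersC_of_sizedDressedLetters (c35 : ℝ) {γP : ℝ} (hMsz : ∀ i, 0 ≤ Msz i)
    (hfib : ∀ i, ∃ N : ℕ, N ≠ 0 ∧ ∀ x, (fibre (π i) x).card = N)
    (hL : ∃ β B ε m m₀ δ a₁ : ℝ, 0 ≤ β ∧ 0 ≤ B ∧ 0 < ε ∧ 0 ≤ m ∧ 0 ≤ m₀ ∧ 0 < δ ∧ 0 < a₁ ∧ ∀ i : I,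
      HasMaj (BlockNorm.ofBlocks (unitTorusGeoS L (kk i) (Mn i) (Msz i)) (fun x => (q i x).1)) (BlockNorm.ofBlocks (unitTorusGeoS L (kk i) (Mn i) (Msz i)) (fun x => (q i x).1)) (Gc i)
        (fun y y' => β * Real.exp (-(δ * (unitTorusGeoS L (kk i) (Mn i) (Msz i)).dist y y'))) ∧
      HasMaj (BlockNorm.ofBlocks (unitTorusGeoS L (kk i) (Mn i) (Msz i)) (fun x' => (q i (π i x')).1)) (BlockNorm.ofBlocks (unitTorusGeoS L (kk i) (Mn i) (Msz i)) (fun x' => (q i (π i x')).1))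
        (Gf i) (fun y y' => β * Real.exp (-(δ * (unitTorusGeoS L (kk i) (Mn i) (Msz i)).dist y y'))) ∧
      HasMaj (BlockNorm.ofBlocks (unitTorusGeoS L (kk i) (Mn i) (Msz i)) (fun x => (q i x).1)) (BlockNorm.ofBlocks (unitTorusGeoS L (kk i) (Mn i) (Msz i)) (fun x' => (q i (π i x')).1))
        (idef (pull (π i)) (pull (π i)) (Gf i) (Gc i)) (fun y y' => m₀ * ((L : ℝ) ^ kk i) ^ (-γP) * Real.exp (-(δ * (unitTorusGeoS L (kk i) (Mn i) (Msz i)).dist y y'))) ∧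
      ∀ (α₀ : ℝ), 0 < α₀ → Msz i * α₀ ≤ a₁ → ∀ U : (Bf i).Cfg, (Bf i).Reg335 c35 α₀ U →
        HasMaj (BlockNorm.ofBlocks (unitTorusGeoS L (kk i) (Mn i) (Msz i)) (fun x => (q i x).1)) (BlockNorm.ofBlocks (unitTorusGeoS L (kk i) (Mn i) (Msz i)) (fun x => (q i x).1))
          (Xco i (avg i U)) (fun y y' => B * Real.exp (-(δ * (unitTorusGeoS L (kk i) (Mn i) (Msz i)).dist y y'))) ∧
        HasMaj (BlockNorm.ofBlocks (unitTorusGeoS L (kk i) (Mn i) (Msz i)) (fun x' => (q i (π i x')).1)) (BlockNorm.ofBlocks (unitTorusGeoS L (kk i) (Mn i) (Msz i)) (fun x' => (q i (π i x')).1))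
          (Xfo i U) (fun y y' => B * Real.exp (-(δ * (unitTorusGeoS L (kk i) (Mn i) (Msz i)).dist y y'))) ∧
        HasMaj (BlockNorm.ofBlocks (unitTorusGeoS L (kk i) (Mn i) (Msz i)) (fun x => (q i x).1)) (BlockNorm.ofBlocks (unitTorusGeoS L (kk i) (Mn i) (Msz i)) (fun x => (q i x).1))
          (Xco i (avg i U) - Gc i) (fun y y' => ε * (Msz i * α₀) * Real.exp (-(δ * (unitTorusGeoS L (kk i) (Mn i) (Msz i)).dist y y'))) ∧
        HasMaj (BlockNorm.ofBlocks (unitTorusGeoS L (kk i) (Mn i) (Msz i)) (fun x' => (q i (π i x')).1)) (BlockNorm.ofBlocks (unitTorusGeoS L (kk i) (Mn i) (Msz i)) (fun x' => (q i (π i x')).1))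
          (Xfo i U - Gf i) (fun y y' => ε * (Msz i * α₀) * Real.exp (-(δ * (unitTorusGeoS L (kk i) (Mn i) (Msz i)).dist y y'))) ∧
        HasMaj (BlockNorm.ofBlocks (unitTorusGeoS L (kk i) (Mn i) (Msz i)) (fun x => (q i x).1)) (BlockNorm.ofBlocks (unitTorusGeoS L (kk i) (Mn i) (Msz i)) (fun x' => (q i (π i x')).1))
          (idef (pull (π i)) (pull (π i)) (Xfo i U) (Xco i (avg i U)))
          (fun y y' => m * ((L : ℝ) ^ kk i) ^ (-γP) * Real.exp (-(δ * (unitTorusGeoS L (kk i) (Mn i) (Msz i)).dist y y')))) :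
    ∃ δP ζ τ a₁ : ℝ, 0 < δP ∧ 0 < ζ ∧ 0 < τ ∧ 0 < a₁ ∧
      ∀ (i : I) (α₀ : ℝ), 0 < α₀ → Msz i * α₀ ≤ a₁ → ∀ U : (Bf i).Cfg, (Bf i).Reg335 c35 α₀ U →
        (∀ p p' : Idx (Mn i) × ι, |siteEntriesC (Mn i) ι (sitePertC (Mn i) ι (q i) (Gc i) (Xco i (avg i U))) p p'| ≤ ζ * (Msz i * α₀) * Real.exp (-(δP * tdist (Mn i) p.1 p'.1))) ∧
        (∀ p p' : Idx (Mn i) × ι, |siteEntriesC (Mn i) ι (sitePertC (Mn i) ι (q i ∘ π i) (Gf i) (Xfo i U)) p p'| ≤ ζ * (Msz i * α₀) * Real.exp (-(δP * tdist (Mn i) p.1 p'.1))) ∧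
        (∀ p p' : Idx (Mn i) × ι, |siteEntriesC (Mn i) ι (sitePertC (Mn i) ι (q i ∘ π i) (Gf i) (Xfo i U)) p p'
              - siteEntriesC (Mn i) ι (sitePertC (Mn i) ι (q i) (Gc i) (Xco i (avg i U))) p p'|
            ≤ τ * ((L : ℝ) ^ kk i) ^ (-γP) * Real.exp (-(δP * tdist (Mn i) p.1 p'.1))) := by
  obtain ⟨β, B, ε, m, m₀, δ, a₁, hβ, hB, hε, hm, hm₀, hδ, ha₁, HL⟩ := hL
  have hLr : (0 : ℝ) ≤ (L : ℝ) := Nat.cast_nonneg _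
  obtain ⟨c, hcdef⟩ : ∃ c : ℝ, c = latticeConst (d + 1) (δ / 2) := ⟨_, rfl⟩
  have hc : 0 ≤ c := hcdef ▸ latticeConst_nonneg _ (by positivity)
  refine ⟨δ / 2, (B + β) * ε * c + 1, 2 * c * (B * m + β * m₀) + 1, a₁, half_pos hδ, by positivity, by positivity, ha₁, fun i α₀ hα₀ hsa U hreg => ?_⟩
  obtain ⟨hGc, hGf, hDG, HU⟩ := HL i
  obtain ⟨hXc, hXf, hEc, hEf, hDX⟩ := HU α₀ hα₀ hsa U hreg
  obtain ⟨N, hN, hfibi⟩ := hfib i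
  have hr : 0 ≤ ((L : ℝ) ^ kk i) ^ (-γP) := Real.rpow_nonneg (pow_nonneg hLr _) _
  have hs0 : 0 ≤ Msz i * α₀ := mul_nonneg (hMsz i) hα₀.le
  have hεs : 0 ≤ ε * (Msz i * α₀) := mul_nonneg hε.le hs0
  -- the two size letters (S2 `hasMaj_siteC` at `r = 0`, site blocks `fst`)
  have hPc := hasMaj_sitePertC L (Mn i) ι (kk i) (Msz i) (q i) hB hβ hεs hδ hXc hGc hEc
  have hPf := hasMaj_sitePertC L (Mn i) ι (kk i) (Msz i) (q i ∘ π i) hB hβ hεs hδ hXf hGf hEf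
  -- the two-grid letter (S2 `hasMaj_idef_siteForm` twice)
  have hPP := hasMaj_sitePertC_sub L (Mn i) ι (kk i) (Msz i) (q i) (π i) hN hfibi hB hβ (mul_nonneg hm hr) (mul_nonneg hm₀ hr) hδ hXc hXf hDX hGc hGf hDG
  refine ⟨fun p p' => ?_, fun p p' => ?_, fun p p' => ?_⟩
  · refine (abs_siteEntriesC_le_of_hasMaj (L := L) (Mn i) ι (kk i) (Msz i) hPc p p').trans ?_
    rw [← hcdef]
    have hE := Real.exp_nonneg (-(δ / 2 * tdist (Mn i) p.1 p'.1))
    have : (B + β) * (ε * (Msz i * α₀)) * c ≤ ((B + β) * ε * c + 1) * (Msz i * α₀) := by nlinarith [mul_nonneg (mul_nonneg (add_nonneg hB hβ) hε.le) hc]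
    nlinarith
  · refine (abs_siteEntriesC_le_of_hasMaj (L := L) (Mn i) ι (kk i) (Msz i) hPf p p').trans ?_
    rw [← hcdef]
    have hE := Real.exp_nonneg (-(δ / 2 * tdist (Mn i) p.1 p'.1))
    have : (B + β) * (ε * (Msz i * α₀)) * c ≤ ((B + β) * ε * c + 1) * (Msz i * α₀) := by nlinarith [mul_nonneg (mul_nonneg (add_nonneg hB hβ) hε.le) hc]
    nlinarith
  · rw [← Matrix.sub_apply, ← siteEntriesC_sub]
    refine (abs_siteEntriesC_le_of_hasMaj (L := L) (Mn i) ι (kk i) (Msz i) hPP p p').trans ?_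
    rw [← hcdef]
    have hE := Real.exp_nonneg (-(δ / 2 * tdist (Mn i) p.1 p'.1))
    have h1 : 2 * c * (B * (m * ((L : ℝ) ^ kk i) ^ (-γP)) + β * (m₀ * ((L : ℝ) ^ kk i) ^ (-γP))) = (2 * c * (B * m + β * m₀)) * ((L : ℝ) ^ kk i) ^ (-γP) := by ring
    rw [h1]
    have h2 : (2 * c * (B * m + β * m₀)) * ((L : ℝ) ^ kk i) ^ (-γP) ≤ (2 * c * (B * m + β * m₀) + 1) * ((L : ℝ) ^ kk i) ^ (-γP) :=
      mul_le_mul_of_nonneg_right (by linarith) hr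
    exact mul_le_mul_of_nonneg_right h2 hE

end Letters

end Summit.QuantumFields.YangMills.BalabanUVNodes.N15.SiteLayerBg

end
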